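import Literature.Topology.FourManifolds.BoundaryGluingRelHomology
import Literature.AlgebraicTopology.SingularHomology.ClopenAdditivity
import HarnessLib

/-!
# `Hₖ(A) → Hₖ(A, ∂A)` vanishes for a piece `A` of a boundary gluing `M = A ∪_φ B` with `Hₖ(M) = 0`
(brick D7 / H4-input of stub `stub_modelsOnFibred_balance` (NF3) of line `modp-braid-orbits`, reshape
r11, crux `ConvexBisection.AcyclicBisectionExists`, item stmt-SmoothPoincare4-10508)

For a boundary gluing `M = A ∪_φ B` of two compact smooth 4-manifolds with boundary
(`IsBoundaryGluing bA bB φ (𝓡 4) M`, tree `Gluing.lean`) and any coefficients `Gr` over `R`: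
**if `Hₖ(M; Gr) = 0` then the map `j_* : Hₖ(A; Gr) → Hₖ(A, ∂A; Gr)` of the long exact sequence of the
pair `(A, ∂A)` is zero** (`helper_ofAbsolute_boundary_eq_zero_of_isBoundaryGluing`).  Proof: by
naturality of `j_*` the composite `Hₖ(A) → Hₖ(A, ∂A) → Hₖ(M, jB B)` equals
`Hₖ(A) → Hₖ(M) → Hₖ(M, jB B)`, which factors through `Hₖ(M) = 0`; and
`(jA)_* : Hₖ(A, ∂A) ≅ Hₖ(M, jB B)` is the excision isomorphism of the gluing (tree
`BoundaryGluingData.isIso_map_jA_boundary'`, Hatcher Thm. 2.20 / Prop. 2.22), in particular a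
monomorphism.  (When the seam is empty the pieces are clopen in `M`, so already `Hₖ(A; Gr) = 0` by
additivity over the clopen partition `M = jA A ⊔ jB B`, Hatcher Prop. 2.6.)

Consequences recorded for the consumers (same hypotheses): every class of `Hₖ(A; Gr)` comes from the
boundary (`Hₖ(∂A) → Hₖ(A)` is epi) and the connecting map `Hₖ₊₁(A, ∂A) → Hₖ(∂A)` is mono.

This is the vocabulary-free homological fact behind "`σ(X) = 0` and `c²(X) = 0`" for the Lefschetz
handlebody `X` of a fibred model `M = X ∪_Ψ Base g` of a rational homology 4-sphere
(Etnyre–Fuller 2006, proof of Thm. 1 / eq. (d3) p. 7; Gompf 1998, Def. 4.2): with `k = 2`, `Gr = ℚ`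
the rational intersection pairing `Q_X(x, y) = ⟨PD (j_* x), y⟩` of `(X, ∂X)` vanishes identically
because `j_* = 0`.  The tree's `intersectionForm` (`IntersectionForm.lean`) is for CLOSED manifolds
only and the signature of a piece is phrased through its closed model `X ∪ cone(∂X)`
(`NovikovAdditivity.lean`); the bilinear-form packaging is therefore left to the consumer.

Everything is proved from tree theorems; no definitions, no named facts, no `sorry`.

## References

* A. Hatcher, *Algebraic Topology*, CUP 2002, §2.1: Prop. 2.6 (additivity), Thm. 2.13 ff. (long
  exact sequence of the pair, naturality of `j_*`), Thm. 2.20 / Prop. 2.22 (excision). [HatcherAT2002]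
* J. Etnyre, T. Fuller, *Realizing 4-manifolds as achiral Lefschetz fibrations*, IMRN 2006, proof of
  Thm. 1 and eq. (d3), p. 7. [EtnyreFuller2006]
-/

noncomputable section

-- the prescribed namespace `Summit.<P>.<Sub>.…` duplicates `SmoothPoincare4` (P = Sub)
set_option linter.dupNamespace false

open scoped Manifold ContDiff Topology
open Set Function CategoryTheory CategoryTheory.Limits
open Literature.AlgebraicTopology.SingularHomology Literature.Topology.FourManifolds

namespace Summit.SmoothPoincare4.SmoothPoincare4.Theorems.AcyclicBisectionExists.ModpBraidOrbits

section Pieces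

variable {M : Type} [TopologicalSpace M] [T2Space M] [ChartedSpace (EuclideanSpace ℝ (Fin 4)) M]
  [IsManifold (𝓡 4) ∞ M]
  {A : Type} [TopologicalSpace A] [T2Space A] [SecondCountableTopology A] [CompactSpace A]
  [ChartedSpace (EuclideanHalfSpace 4) A] [IsManifold (𝓡∂ 4) ∞ A]
  {B : Type} [TopologicalSpace B] [T2Space B] [SecondCountableTopology B] [CompactSpace B]
  [ChartedSpace (EuclideanHalfSpace 4) B] [IsManifold (𝓡∂ 4) ∞ B]
  {R : Type} [CommRing R] {Gr : Type} [AddCommGroup Gr] [Module R Gr]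

omit [ChartedSpace (EuclideanSpace ℝ (Fin 4)) M] [IsManifold (𝓡 4) ∞ M] [T2Space A]
  [SecondCountableTopology A] [IsManifold (𝓡∂ 4) ∞ A] [T2Space B] [SecondCountableTopology B]
  [IsManifold (𝓡∂ 4) ∞ B] in
/-- **Empty seam: a piece is a union of components, so `Hₖ(A) ↪ Hₖ(M)`.**  If the two pieces of a
closed gluing `M = jA A ∪ jB B` meet along an EMPTY boundary, their (compact, hence closed) ranges are
complementary clopen subsets of the Hausdorff `M`, so `(jA)_* : Hₖ(A; Gr) → Hₖ(M; Gr)` is injective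
by additivity of homology over the clopen partition (Hatcher Prop. 2.6, tree
`singularHomology.map_subsetIncl_injective_of_isClopenPartition`); hence `Hₖ(M) = 0 ⇒ Hₖ(A) = 0`.
[cite: HatcherAT2002, §2.1 Prop. 2.6] -/
theorem isZero_homology_piece_of_isEmpty_seam (bA : BoundaryData (𝓡∂ 4) A (𝓡 3))
    [IsEmpty bA.carrier] (bB : BoundaryData (𝓡∂ 4) B (𝓡 3)) (φ : bA.carrier → bB.carrier)
    {jA : A → M} {jB : B → M} (hjA : Topology.IsEmbedding jA) (hjB : Continuous jB)
    (hcover : range jA ∪ range jB = univ)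
    (hR : ∀ a b, jA a = jB b ↔ ∃ z, a = bA.incl z ∧ b = bB.incl (φ z)) {k : ℕ}
    (hk : IsZero (singularHomology R Gr M k)) : IsZero (singularHomology R Gr A k) := by
  -- the two ranges are complementary
  have hdisj : Disjoint (range jA) (range jB) := by
    rw [Set.disjoint_left]
    rintro _ ⟨a, rfl⟩ ⟨b, hb⟩
    obtain ⟨z, -, -⟩ := (hR a b).mp hb.symm
    exact isEmptyElim z
  have hcompl : (range jA)ᶜ = range jB := by
    refine Set.Subset.antisymm (fun x hx => ?_) fun x hx hx' => Set.disjoint_left.mp hdisj hx' hx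
    have hx' : x ∈ range jA ∪ range jB := hcover ▸ Set.mem_univ x
    exact hx'.resolve_left hx
  have hopen : IsOpen (range jA) := by
    rw [← compl_compl (range jA), hcompl]
    exact (isCompact_range hjB).isClosed.isOpen_compl
  have hopen' : IsOpen (range jA)ᶜ := (isCompact_range hjA.continuous).isClosed.isOpen_compl
  -- the clopen partition `M = jA A ⊔ (jA A)ᶜ`
  have hP : IsClopenPartition (fun b : Bool => cond b (range jA) (range jA)ᶜ) :=
    { isOpen := by
        rintro (_ | _)
        · exact hopen'
        · exact hopen
      disjoint := by
        rintro (_ | _) (_ | _) hjk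
        · exact absurd rfl hjk
        · exact disjoint_compl_left
        · exact disjoint_compl_right
        · exact absurd rfl hjk
      exists_mem := fun z => by
        by_cases hz : z ∈ range jA
        · exact ⟨true, hz⟩
        · exact ⟨false, hz⟩ }
  have hinj : Injective (singularHomology.map R Gr (subsetIncl (range jA)) k) :=
    singularHomology.map_subsetIncl_injective_of_isClopenPartition hP true k
  haveI : Mono (singularHomology.map R Gr (subsetIncl (range jA)) k) :=
    (ModuleCat.mono_iff_injective _).mpr hinj
  exact (IsZero.of_mono (singularHomology.map R Gr (subsetIncl (range jA)) k) hk).of_iso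
    (singularHomology.mapIso R Gr hjA.toHomeomorph k)

omit [T2Space M] in
/-- **Nonempty seam: `Hₖ(A) → Hₖ(A, ∂A)` is zero by excision for the gluing.**  For gluing witnesses
`jA`, `jB` of `M = A ∪_φ B` with `∂A ≠ ∅` and `Hₖ(M; Gr) = 0`: by naturality of `j_*`
(`relativeSingularHomology.ofAbsolute_comp_map`) the composite
`Hₖ(A) → Hₖ(A, ∂A) → Hₖ(M, jB B)` is `Hₖ(A) → Hₖ(M) → Hₖ(M, jB B) = 0`, and
`(jA)_* : Hₖ(A, ∂A; Gr) ≅ Hₖ(M, jB B; Gr)` (tree `BoundaryGluingData.isIso_map_jA_boundary'`, read on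
the null-cobordisms `A`, `B` of the abstract boundaries `bA.carrier`, `bB.carrier`) is mono.
[cite: HatcherAT2002, §2.1 Thm. 2.20 and Prop. 2.22] -/
theorem ofAbsolute_boundary_eq_zero_of_nonempty_seam (bA : BoundaryData (𝓡∂ 4) A (𝓡 3))
    [Nonempty bA.carrier] (bB : BoundaryData (𝓡∂ 4) B (𝓡 3)) (φ : bA.carrier ≃ bB.carrier)
    {jA : A → M} {jB : B → M} (hjA : Manifold.IsSmoothEmbedding (𝓡∂ 4) (𝓡 4) ∞ jA)
    (hjB : Manifold.IsSmoothEmbedding (𝓡∂ 4) (𝓡 4) ∞ jB) (hcover : range jA ∪ range jB = univ)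
    (hR : ∀ a b, jA a = jB b ↔ ∃ z, a = bA.incl z ∧ b = bB.incl (φ z)) {k : ℕ}
    (hk : IsZero (singularHomology R Gr M k)) :
    relativeSingularHomology.ofAbsolute R Gr A ((𝓡∂ 4).boundary A) k = 0 := by
  -- bridging instances at `2 + 1 + 1` / `2 + 1`
  letI iA1 : ChartedSpace (EuclideanHalfSpace (2 + 1 + 1)) A := ‹ChartedSpace (EuclideanHalfSpace 4) A›
  letI iA2 : IsManifold (𝓡∂ (2 + 1 + 1)) ∞ A := ‹IsManifold (𝓡∂ 4) ∞ A›
  letI iB1 : ChartedSpace (EuclideanHalfSpace (2 + 1 + 1)) B := ‹ChartedSpace (EuclideanHalfSpace 4) B›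
  letI iB2 : IsManifold (𝓡∂ (2 + 1 + 1)) ∞ B := ‹IsManifold (𝓡∂ 4) ∞ B›
  letI iM1 : ChartedSpace (EuclideanSpace ℝ (Fin (2 + 1 + 1))) M :=
    ‹ChartedSpace (EuclideanSpace ℝ (Fin 4)) M›
  letI iM2 : IsManifold (𝓡 (2 + 1 + 1)) ∞ M := ‹IsManifold (𝓡 4) ∞ M›
  letI ia3 : ChartedSpace (EuclideanSpace ℝ (Fin (2 + 1))) bA.carrier := bA.chartedSpace
  letI ia4 : IsManifold (𝓡 (2 + 1)) ∞ bA.carrier := bA.isManifold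
  letI ib3 : ChartedSpace (EuclideanSpace ℝ (Fin (2 + 1))) bB.carrier := bB.chartedSpace
  letI ib4 : IsManifold (𝓡 (2 + 1)) ∞ bB.carrier := bB.isManifold
  haveI : CompactSpace bA.carrier := bA.compactSpace_carrier
  haveI : T2Space bA.carrier := bA.isSmoothEmbedding.isEmbedding.t2Space
  -- the pieces as null-cobordisms of their abstract boundaries, and the gluing data over them
  let cA : NullCobordism (2 + 1) bA.carrier :=
    { W := A
      incl := bA.incl
      isSmoothEmbedding_incl := bA.isSmoothEmbedding
      range_incl := bA.range_incl }
  let cB : NullCobordism (2 + 1) bB.carrier :=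
    { W := B
      incl := bB.incl
      isSmoothEmbedding_incl := bB.isSmoothEmbedding
      range_incl := bB.range_incl }
  let G : BoundaryGluingData cA.boundaryData cB.boundaryData φ M :=
    { jA := jA
      jB := jB
      isSmoothEmbedding_jA := hjA
      isSmoothEmbedding_jB := hjB
      range_union := hcover
      jA_eq_jB_iff := hR }
  haveI := G.isIso_map_jA_boundary' R Gr k
  -- naturality of `j_*` along the map of pairs `jA : (A, ∂A) → (M, jB B)`
  have hnat := relativeSingularHomology.ofAbsolute_comp_map R Gr
    (⟨G.jA, G.continuous_jA⟩ : C(cA.W, M)) G.mapsTo_jA_boundary k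
  rw [hk.eq_of_tgt (singularHomology.map R Gr (⟨G.jA, G.continuous_jA⟩ : C(cA.W, M)) k) 0,
    zero_comp] at hnat
  rw [← cancel_mono (relativeSingularHomology.map R Gr (⟨G.jA, G.continuous_jA⟩ : C(cA.W, M))
    G.mapsTo_jA_boundary k), zero_comp]
  exact hnat

/-- **`Hₖ(A) → Hₖ(A, ∂A)` is zero for a piece of a closed gluing with `Hₖ(M) = 0`** (gluing witnesses
unpacked; both cases of the seam). [cite: HatcherAT2002, §2.1 Thm. 2.20 and Prop. 2.22] -/
theorem ofAbsolute_boundary_eq_zero_of_gluing (bA : BoundaryData (𝓡∂ 4) A (𝓡 3))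
    (bB : BoundaryData (𝓡∂ 4) B (𝓡 3)) (φ : bA.carrier ≃ bB.carrier)
    {jA : A → M} {jB : B → M} (hjA : Manifold.IsSmoothEmbedding (𝓡∂ 4) (𝓡 4) ∞ jA)
    (hjB : Manifold.IsSmoothEmbedding (𝓡∂ 4) (𝓡 4) ∞ jB) (hcover : range jA ∪ range jB = univ)
    (hR : ∀ a b, jA a = jB b ↔ ∃ z, a = bA.incl z ∧ b = bB.incl (φ z)) {k : ℕ}
    (hk : IsZero (singularHomology R Gr M k)) :
    relativeSingularHomology.ofAbsolute R Gr A ((𝓡∂ 4).boundary A) k = 0 := by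
  rcases isEmpty_or_nonempty bA.carrier with hE | hN
  · exact (isZero_homology_piece_of_isEmpty_seam bA bB φ hjA.isEmbedding hjB.isEmbedding.continuous
      hcover hR hk).eq_of_src _ _
  · exact ofAbsolute_boundary_eq_zero_of_nonempty_seam bA bB φ hjA hjB hcover hR hk

/-- **`Hₖ(A) → Hₖ(A, ∂A)` is zero for the first piece of a boundary gluing `M = A ∪_φ B` with
`Hₖ(M; Gr) = 0`** (`IsBoundaryGluing` form, `φ` a diffeomorphism of the abstract boundaries as in
`LefschetzBase.ModelsOnFibred`). [cite: HatcherAT2002, §2.1 Thm. 2.20 and Prop. 2.22] -/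
theorem ofAbsolute_boundary_eq_zero_of_isBoundaryGluing (bA : BoundaryData (𝓡∂ 4) A (𝓡 3))
    (bB : BoundaryData (𝓡∂ 4) B (𝓡 3)) (φ : bA.carrier ≃ₘ⟮𝓡 3, 𝓡 3⟯ bB.carrier)
    (h : IsBoundaryGluing bA bB φ (𝓡 4) M) {k : ℕ} (hk : IsZero (singularHomology R Gr M k)) :
    relativeSingularHomology.ofAbsolute R Gr A ((𝓡∂ 4).boundary A) k = 0 := by
  obtain ⟨jA, jB, hjA, hjB, hcover, hR⟩ := h
  exact ofAbsolute_boundary_eq_zero_of_gluing bA bB φ.toEquiv hjA hjB hcover hR hk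

/-- **Every class of `Hₖ(A; Gr)` comes from the boundary**: `Hₖ(∂A; Gr) → Hₖ(A; Gr)` is an
epimorphism for the first piece of a boundary gluing with `Hₖ(M; Gr) = 0` (exactness of
`Hₖ(∂A) → Hₖ(A) → Hₖ(A, ∂A)` and `j_* = 0`). [cite: HatcherAT2002, §2.1 Thm. 2.13 ff. and Thm. 2.20] -/
theorem epi_map_boundary_of_isBoundaryGluing (bA : BoundaryData (𝓡∂ 4) A (𝓡 3))
    (bB : BoundaryData (𝓡∂ 4) B (𝓡 3)) (φ : bA.carrier ≃ₘ⟮𝓡 3, 𝓡 3⟯ bB.carrier)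
    (h : IsBoundaryGluing bA bB φ (𝓡 4) M) {k : ℕ} (hk : IsZero (singularHomology R Gr M k)) :
    Epi (singularHomology.map R Gr (subsetIncl ((𝓡∂ 4).boundary A)) k) :=
  (relativeSingularHomology.exact_map_ofAbsolute R Gr ((𝓡∂ 4).boundary A) k).epi_f
    (ofAbsolute_boundary_eq_zero_of_isBoundaryGluing bA bB φ h hk)

/-- **The connecting map `Hₖ₊₁(A, ∂A; Gr) → Hₖ(∂A; Gr)` is a monomorphism** for the first piece of a
boundary gluing with `Hₖ₊₁(M; Gr) = 0` (exactness of `Hₖ₊₁(A) → Hₖ₊₁(A, ∂A) → Hₖ(∂A)` and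
`j_* = 0`). [cite: HatcherAT2002, §2.1 Thm. 2.13 ff. and Thm. 2.20] -/
theorem mono_δ_boundary_of_isBoundaryGluing (bA : BoundaryData (𝓡∂ 4) A (𝓡 3))
    (bB : BoundaryData (𝓡∂ 4) B (𝓡 3)) (φ : bA.carrier ≃ₘ⟮𝓡 3, 𝓡 3⟯ bB.carrier)
    (h : IsBoundaryGluing bA bB φ (𝓡 4) M) {k : ℕ}
    (hk : IsZero (singularHomology R Gr M (k + 1))) :
    Mono (relativeSingularHomology.δ R Gr A ((𝓡∂ 4).boundary A) k) :=
  (relativeSingularHomology.exact_ofAbsolute_δ R Gr ((𝓡∂ 4).boundary A) k).mono_g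
    (ofAbsolute_boundary_eq_zero_of_isBoundaryGluing bA bB φ h hk)

end Pieces

/-! ## The registered bricks -/

/-- **Brick `helper_ofAbsolute_boundary_eq_zero_of_isBoundaryGluing` of stub
`stub_modelsOnFibred_balance` (NF3).**  For a boundary gluing `M = A ∪_φ B` of compact smooth
4-manifolds with boundary along a diffeomorphism `φ : ∂A ≅ ∂B` of boundary data, any coefficients
`Gr` over `R` and any degree `k`: if `Hₖ(M; Gr) = 0` then the map `j_* : Hₖ(A; Gr) → Hₖ(A, ∂A; Gr)`
is zero — it factors as `Hₖ(A) → Hₖ(M) = 0 → Hₖ(M, jB B) ≅ Hₖ(A, ∂A)` (excision for the gluing,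
Hatcher Thm. 2.20 / Prop. 2.22).  With `k = 2`, `Gr = ℚ`, `A = X(F; l)` the Lefschetz handlebody of a
fibred model of a rational homology 4-sphere this is "`Q_X ≡ 0`, hence `σ(X) = 0 = c²(X)`" in
Etnyre–Fuller's computation of `d₃` (2006, eq. (d3) p. 7). [cite: HatcherAT2002, §2.1 Thm. 2.20 and Prop. 2.22] -/
theorem helper_ofAbsolute_boundary_eq_zero_of_isBoundaryGluing :
    ∀ (M : Type) [TopologicalSpace M] [T2Space M] [ChartedSpace (EuclideanSpace ℝ (Fin 4)) M]
      [IsManifold (𝓡 4) ∞ M]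
      (A : Type) [TopologicalSpace A] [T2Space A] [SecondCountableTopology A] [CompactSpace A]
      [ChartedSpace (EuclideanHalfSpace 4) A] [IsManifold (𝓡∂ 4) ∞ A]
      (B : Type) [TopologicalSpace B] [T2Space B] [SecondCountableTopology B] [CompactSpace B]
      [ChartedSpace (EuclideanHalfSpace 4) B] [IsManifold (𝓡∂ 4) ∞ B]
      (bA : Literature.Topology.FourManifolds.BoundaryData (𝓡∂ 4) A (𝓡 3))
      (bB : Literature.Topology.FourManifolds.BoundaryData (𝓡∂ 4) B (𝓡 3))
      (φ : bA.carrier ≃ₘ⟮𝓡 3, 𝓡 3⟯ bB.carrier),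
      Literature.Topology.FourManifolds.IsBoundaryGluing bA bB φ (𝓡 4) M →
      ∀ (R : Type) [CommRing R] (Gr : Type) [AddCommGroup Gr] [Module R Gr] (k : ℕ),
        CategoryTheory.Limits.IsZero
          (Literature.AlgebraicTopology.SingularHomology.singularHomology R Gr M k) →
        Literature.AlgebraicTopology.SingularHomology.relativeSingularHomology.ofAbsolute R Gr A
          ((𝓡∂ 4).boundary A) k = 0 := by
  intro M _ _ _ _ A _ _ _ _ _ _ B _ _ _ _ _ _ bA bB φ h R _ Gr _ _ k hk
  exact ofAbsolute_boundary_eq_zero_of_isBoundaryGluing bA bB φ h hk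

/-- **Brick `helper_epi_map_boundary_of_isBoundaryGluing` of stub `stub_modelsOnFibred_balance`
(NF3)**: for a boundary gluing `M = A ∪_φ B` with `Hₖ(M; Gr) = 0`, every class of `Hₖ(A; Gr)` comes
from the boundary — `Hₖ(∂A; Gr) → Hₖ(A; Gr)` is an epimorphism (long exact sequence of the pair and
`j_* = 0`). [cite: HatcherAT2002, §2.1 Thm. 2.13 ff. and Thm. 2.20] -/
theorem helper_epi_map_boundary_of_isBoundaryGluing :
    ∀ (M : Type) [TopologicalSpace M] [T2Space M] [ChartedSpace (EuclideanSpace ℝ (Fin 4)) M]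
      [IsManifold (𝓡 4) ∞ M]
      (A : Type) [TopologicalSpace A] [T2Space A] [SecondCountableTopology A] [CompactSpace A]
      [ChartedSpace (EuclideanHalfSpace 4) A] [IsManifold (𝓡∂ 4) ∞ A]
      (B : Type) [TopologicalSpace B] [T2Space B] [SecondCountableTopology B] [CompactSpace B]
      [ChartedSpace (EuclideanHalfSpace 4) B] [IsManifold (𝓡∂ 4) ∞ B]
      (bA : Literature.Topology.FourManifolds.BoundaryData (𝓡∂ 4) A (𝓡 3))
      (bB : Literature.Topology.FourManifolds.BoundaryData (𝓡∂ 4) B (𝓡 3))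
      (φ : bA.carrier ≃ₘ⟮𝓡 3, 𝓡 3⟯ bB.carrier),
      Literature.Topology.FourManifolds.IsBoundaryGluing bA bB φ (𝓡 4) M →
      ∀ (R : Type) [CommRing R] (Gr : Type) [AddCommGroup Gr] [Module R Gr] (k : ℕ),
        CategoryTheory.Limits.IsZero
          (Literature.AlgebraicTopology.SingularHomology.singularHomology R Gr M k) →
        CategoryTheory.Epi (Literature.AlgebraicTopology.SingularHomology.singularHomology.map R Gr
          (Literature.AlgebraicTopology.SingularHomology.subsetIncl ((𝓡∂ 4).boundary A)) k) := by
  intro M _ _ _ _ A _ _ _ _ _ _ B _ _ _ _ _ _ bA bB φ h R _ Gr _ _ k hk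
  exact epi_map_boundary_of_isBoundaryGluing bA bB φ h hk

/-- **Brick `helper_mono_delta_boundary_of_isBoundaryGluing` of stub `stub_modelsOnFibred_balance`
(NF3)**: for a boundary gluing `M = A ∪_φ B` with `Hₖ₊₁(M; Gr) = 0`, the connecting map
`∂ : Hₖ₊₁(A, ∂A; Gr) → Hₖ(∂A; Gr)` is a monomorphism (long exact sequence of the pair and `j_* = 0`).
[cite: HatcherAT2002, §2.1 Thm. 2.13 ff. and Thm. 2.20] -/
theorem helper_mono_delta_boundary_of_isBoundaryGluing :
    ∀ (M : Type) [TopologicalSpace M] [T2Space M] [ChartedSpace (EuclideanSpace ℝ (Fin 4)) M]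
      [IsManifold (𝓡 4) ∞ M]
      (A : Type) [TopologicalSpace A] [T2Space A] [SecondCountableTopology A] [CompactSpace A]
      [ChartedSpace (EuclideanHalfSpace 4) A] [IsManifold (𝓡∂ 4) ∞ A]
      (B : Type) [TopologicalSpace B] [T2Space B] [SecondCountableTopology B] [CompactSpace B]
      [ChartedSpace (EuclideanHalfSpace 4) B] [IsManifold (𝓡∂ 4) ∞ B]
      (bA : Literature.Topology.FourManifolds.BoundaryData (𝓡∂ 4) A (𝓡 3))
      (bB : Literature.Topology.FourManifolds.BoundaryData (𝓡∂ 4) B (𝓡 3))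
      (φ : bA.carrier ≃ₘ⟮𝓡 3, 𝓡 3⟯ bB.carrier),
      Literature.Topology.FourManifolds.IsBoundaryGluing bA bB φ (𝓡 4) M →
      ∀ (R : Type) [CommRing R] (Gr : Type) [AddCommGroup Gr] [Module R Gr] (k : ℕ),
        CategoryTheory.Limits.IsZero
          (Literature.AlgebraicTopology.SingularHomology.singularHomology R Gr M (k + 1)) →
        CategoryTheory.Mono
          (Literature.AlgebraicTopology.SingularHomology.relativeSingularHomology.δ R Gr A
            ((𝓡∂ 4).boundary A) k) := by
  intro M _ _ _ _ A _ _ _ _ _ _ B _ _ _ _ _ _ bA bB φ h R _ Gr _ _ k hk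
  exact mono_δ_boundary_of_isBoundaryGluing bA bB φ h hk

end Summit.SmoothPoincare4.SmoothPoincare4.Theorems.AcyclicBisectionExists.ModpBraidOrbits

end
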